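import Literature.MathematicalPhysics.QuantumFieldTheory.LatticeGaugeAsymptotics
import Literature.MathematicalPhysics.QuantumLattice.LatticeGaugeDLRLimitPointsProofs
import HarnessLib

/-!
# Discharge: infinite-volume limit points of `4`-dimensional `ℤ₂` lattice gauge theory exist
(`Literature.MathematicalPhysics.QuantumFieldTheory.infiniteVolumeLimitPoints_z2Rep_nonempty`)

Sibling proof file of `Literature/MathematicalPhysics/QuantumFieldTheory/LatticeGaugeAsymptotics.lean`
(constructive-qft.S18, Chatterjee's Wilson-loop asymptotics in Ising lattice gauge theory): it
discharges the named fact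
`Literature.MathematicalPhysics.QuantumFieldTheory.infiniteVolumeLimitPoints_z2Rep_nonempty` (D-0014) as
`Literature.MathematicalPhysics.QuantumFieldTheory.infiniteVolumeLimitPoints_z2Rep_nonempty_holds`.
No definition or statement is introduced.

The fact: for every inverse coupling `β`, the set `infiniteVolumeLimitPoints (d := 4) z2Rep β` of
subsequential limits (on bounded continuous cylinder observables) of the torus Wilson states of
`ℤ₂ = Multiplicative (ZMod 2)` lattice gauge theory on `ℤ⁴` is non-empty — the non-vacuity of the
state quantifier in `chatterjee_z2_wilsonLoops`.

## Proof

This is the special case `G = Multiplicative (ZMod 2)`, `ρ = z2Rep`, `d = 4` of the general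
compactness theorem
`Literature.MathematicalPhysics.QuantumLattice.infiniteVolumeLimitPoints_nonempty_holds`
(file `Literature/MathematicalPhysics/QuantumLattice/LatticeGaugeDLRLimitPointsProofs.lean`,
whence the second import; that file is downstream of the heavy torus layer `LatticeGaugeProofs`,
so the discharge is kept out of the statements file): `ℤ₂` carries the discrete topology
(Mathlib, `Mathlib.Topology.Instances.ZMod`, transferred to `Multiplicative`), hence is a compact
second-countable Hausdorff group, its Borel structure is supplied by the transfer instances of
the statements file together with `Countable.instBorelSpace`, and `z2Rep` is continuous
(`continuous_of_discreteTopology`). This is literally the interim proof preserved as a comment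
in the statements file. Chatterjee states the same compactness argument for the `ℤ₂` theory:
the edge-spin configuration space of `ℤ⁴` "is a compact metric space. Consequently, any
sequence of probability measures on `Σ` has a subsequential weak limit" (CMP 377 (2020), §6
"Distribution of vortices", opening paragraphs; he uses free boundary conditions on cubes, the
statements file uses torus states — the argument is the same).

## References

* S. Chatterjee, *Wilson loops in Ising lattice gauge theory*, Comm. Math. Phys. 377 (2020)
  307–340, arXiv:1811.09770, §6 (existence of subsequential infinite-volume limits by
  compactness).
* S. Chatterjee, *Yang–Mills for probabilists*, in: Probability and Analysis in Interacting
  Physical Systems (Springer 2019), arXiv:1803.01950, section "Lattice gauge theories"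
  (infinite volume limits as weak limits of the finite-volume theories).
* E. Seiler, *Gauge Theories as a Problem of Constructive Quantum Field Theory and Statistical
  Mechanics*, LNP 159 (Springer 1982), Ch. 2.
-/

open Literature.MathematicalPhysics.QuantumLattice

namespace Literature.MathematicalPhysics.QuantumFieldTheory

/-- **Discharge of `infiniteVolumeLimitPoints_z2Rep_nonempty`.** For every `β`, the torus Wilson
states of `4`-dimensional `ℤ₂` lattice gauge theory have a subsequential infinite-volume limit on
bounded continuous cylinder observables, i.e. `(infiniteVolumeLimitPoints (d := 4) z2Rep β).Nonempty`:
the special case `G = ℤ₂` (finite discrete, so compact, second countable, Hausdorff; `z2Rep`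
continuous) of `Literature.MathematicalPhysics.QuantumLattice.infiniteVolumeLimitPoints_nonempty_holds`
(compactness of the space of probability measures on the compact metrizable configuration space;
Chatterjee, CMP 377 (2020) §6: "`Σ` is a compact metric space. Consequently, any sequence of
probability measures on `Σ` has a subsequential weak limit"). [cite: arXiv181109770, §6] -/
theorem infiniteVolumeLimitPoints_z2Rep_nonempty_holds : infiniteVolumeLimitPoints_z2Rep_nonempty :=
  fun β => infiniteVolumeLimitPoints_nonempty_holds (d := 4) z2Rep continuous_of_discreteTopology β

end Literature.MathematicalPhysics.QuantumFieldTheory
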